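import Literature.Analysis.Convexity.AnisotropicPerimeterTransform
import Literature.MathematicalPhysics.StatisticalMechanics.FccWulffBodyHull
import Summits.Ventures.Crystal3D.Theorems.StickyWulffConstantPolycrystalWulffBoundSingleGrain

/-!
# `PolycrystalWulffBound`: the Wulff body of the crux has `|W_A| = 32` and `Per_{W_A}(W_A) = 96`

Route `StickyWulffConstant` of the venture `Summits/Ventures/Crystal3D`, crux `PolycrystalWulffBound`
(item `stmt-Ventures-19482`, continuum regime P) and its sibling `TextureLiminf` (item
`stmt-Ventures-19483`, regime T). In the crux's own `let`-vocabulary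

  `Φ(ν) = (√2/4) Σ_{w ∈ Λ₀, ‖w‖ = 1} |⟪w, ν⟫|`, `W_A = {y | ∀ ν, ⟪y, ν⟫ ≤ Φ(A⁻¹ ν)}`,
  `Per K S = (sup {∫_S div ξ : ξ ∈ C¹_c, ξ(z) ∈ K}).toReal`,

this file proves the EQUALITY CASE of the one-grain Wulff inequality
(`polycrystalWulffBound_singleGrain`: `6·2^{1/3}(√2|G|)^{2/3} ≤ Per_{W_A}(G)`):

* `volume_cruxWulffBody` : `|W_A| = 32` (so `√2·|W_A| = 32√2` and `6·2^{1/3}(32√2)^{2/3} = 96`);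
* `per_cruxWulffBody_self` : `Per_{W_A}(W_A) = 96`;
* `per_cruxWulffBody_vadd_smul` : `Per_{W_A}(x₀ + r W_A) = 96 r²` (`r > 0`), with
  `volume_vadd_smul_cruxWulffBody` : `|x₀ + r W_A| = 32 r³` and the identity
  `wulff_constant_smul` : `6·2^{1/3}(√2·32 r³)^{2/3} = 96 r²` — i.e. every translated, dilated Wulff
  grain is an EXACT minimiser of the one-grain functional.

These are the ingredients of the sanity reduction «LiminfAssembly ∧ [Per_W(W) = 96] ⟹ TextureLiminf»
(cf-p1 T-NOTE §1: the single texture "one Wulff grain of mass `1 − δ/2`" has energy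
`κ(1 − δ/2)^{2/3} < κ`), now unconditional on the bracket. Proof: `W_A = (A ∘ L)(W_cubic)`
(`wulffBody_eq_image`), `W_cubic = conv{perm(0,±1,±2)}` (`fccWulffBody_eq_setOf_forall_inner`),
isometry invariance of volume and of the anisotropic perimeter
(`anisotropicPerimeter_image_linearIsometryEquiv`), and Maggi's `Φ(W_Φ) = n|W_Φ|`
(`anisotropicPerimeter_fccWulffBody_self`, `anisotropicPerimeter_vadd_smul_self`).
WHAT THIS IS NOT: anything about textures with two or more grains (the wall terms of P), nor the
compactness half of T.
-/

noncomputable section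

namespace Summit.Ventures.Crystal3D.Theorems

open MeasureTheory Set
open scoped RealInnerProductSpace ENNReal Pointwise
open Literature.MathematicalPhysics.StatisticalMechanics
open Literature.Analysis.Convexity (anisotropicPerimeter anisotropicPerimeter_image_linearIsometryEquiv
  anisotropicPerimeter_vadd_smul_self)
open Literature.Geometry.DiscreteGeometry (fccKissingPattern)

/-- The crux's Wulff body in orientation `A` is an isometric image of the fcc Wulff body
`conv{perm(0, ±1, ±2)}`: `W_A = (A ∘ L) '' fccWulffBody`. -/
theorem cruxWulffBody_eq_image_fccWulffBody
    {L : EuclideanSpace ℝ (Fin 3) ≃ₗᵢ[ℝ] EuclideanSpace ℝ (Fin 3)}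
    (hL : {w | w ∈ fccStacking 1 (Real.sqrt (2 / 3)) ∧ ‖w‖ = 1} =
      L '' (fccKissingPattern : Set (EuclideanSpace ℝ (Fin 3))))
    (A : EuclideanSpace ℝ (Fin 3) ≃ₗᵢ[ℝ] EuclideanSpace ℝ (Fin 3)) :
    {y : EuclideanSpace ℝ (Fin 3) | ∀ ν : EuclideanSpace ℝ (Fin 3), ⟪y, ν⟫ ≤ Real.sqrt 2 / 4 *
        ∑ᶠ w ∈ {w | w ∈ fccStacking 1 (Real.sqrt (2 / 3)) ∧ ‖w‖ = 1}, |⟪w, A.symm ν⟫|} =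
      (L.trans A) '' fccWulffBody := by
  rw [wulffBody_eq_image hL A, fccWulffBody_eq_setOf_forall_inner]

/-- **`|W_A| = 32`**: the crux's Wulff body in every orientation `A` has volume `32`
(the `|W|` of the single-crystal constant `3|W|^{1/3} = 6·2^{1/3}·2^{1/3}`, in the crux's
normalisation `6·2^{1/3}(√2·V)^{2/3}`). -/
theorem volume_cruxWulffBody (A : EuclideanSpace ℝ (Fin 3) ≃ₗᵢ[ℝ] EuclideanSpace ℝ (Fin 3)) :
    volume {y : EuclideanSpace ℝ (Fin 3) | ∀ ν : EuclideanSpace ℝ (Fin 3), ⟪y, ν⟫ ≤ Real.sqrt 2 / 4 *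
        ∑ᶠ w ∈ {w | w ∈ fccStacking 1 (Real.sqrt (2 / 3)) ∧ ‖w‖ = 1}, |⟪w, A.symm ν⟫|} =
      ENNReal.ofReal 32 := by
  obtain ⟨L, hL⟩ := exists_linearIsometryEquiv_unitShell_eq
  rw [cruxWulffBody_eq_image_fccWulffBody hL A, LinearIsometryEquiv.image_eq_preimage_symm,
    (L.trans A).symm.measurePreserving.measure_preimage
      isCompact_fccWulffBody.measurableSet.nullMeasurableSet, volume_fccWulffBody]

/-- **`Per_{W_A}(W_A) = 96`** in the crux's `toReal` spelling of the `K`-perimeter: the equality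
case of the one-grain Wulff inequality `polycrystalWulffBound_singleGrain` at `G = W_A`
(`6·2^{1/3}·(√2·32)^{2/3} = 96`). -/
theorem per_cruxWulffBody_self (A : EuclideanSpace ℝ (Fin 3) ≃ₗᵢ[ℝ] EuclideanSpace ℝ (Fin 3)) :
    (⨆ (ξ : EuclideanSpace ℝ (Fin 3) → EuclideanSpace ℝ (Fin 3))
        (_ : ContDiff ℝ 1 ξ ∧ HasCompactSupport ξ ∧ ∀ z, ξ z ∈
          {y : EuclideanSpace ℝ (Fin 3) | ∀ ν : EuclideanSpace ℝ (Fin 3), ⟪y, ν⟫ ≤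
            Real.sqrt 2 / 4 * ∑ᶠ w ∈ {w | w ∈ fccStacking 1 (Real.sqrt (2 / 3)) ∧ ‖w‖ = 1},
              |⟪w, A.symm ν⟫|}),
        ENNReal.ofReal (∫ z in {y : EuclideanSpace ℝ (Fin 3) | ∀ ν : EuclideanSpace ℝ (Fin 3),
          ⟪y, ν⟫ ≤ Real.sqrt 2 / 4 * ∑ᶠ w ∈ {w | w ∈ fccStacking 1 (Real.sqrt (2 / 3)) ∧ ‖w‖ = 1},
              |⟪w, A.symm ν⟫|}, fieldDivergence ξ z)).toReal = 96 := by
  obtain ⟨L, hL⟩ := exists_linearIsometryEquiv_unitShell_eq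
  change (anisotropicPerimeter _ _).toReal = 96
  rw [cruxWulffBody_eq_image_fccWulffBody hL A, anisotropicPerimeter_image_linearIsometryEquiv,
    anisotropicPerimeter_fccWulffBody_self, ENNReal.toReal_ofReal (by norm_num)]

/-- **`Per_{W_A}(x₀ + r·W_A) = 96·r²`** (`r > 0`): Maggi's `Φ(x₀ + r W_Φ) = n r^{n-1}|W_Φ|` for the
crux's Wulff body, in its `toReal` spelling. -/
theorem per_cruxWulffBody_vadd_smul (A : EuclideanSpace ℝ (Fin 3) ≃ₗᵢ[ℝ] EuclideanSpace ℝ (Fin 3))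
    (x₀ : EuclideanSpace ℝ (Fin 3)) {r : ℝ} (hr : 0 < r) :
    (⨆ (ξ : EuclideanSpace ℝ (Fin 3) → EuclideanSpace ℝ (Fin 3))
        (_ : ContDiff ℝ 1 ξ ∧ HasCompactSupport ξ ∧ ∀ z, ξ z ∈
          {y : EuclideanSpace ℝ (Fin 3) | ∀ ν : EuclideanSpace ℝ (Fin 3), ⟪y, ν⟫ ≤
            Real.sqrt 2 / 4 * ∑ᶠ w ∈ {w | w ∈ fccStacking 1 (Real.sqrt (2 / 3)) ∧ ‖w‖ = 1},
              |⟪w, A.symm ν⟫|}),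
        ENNReal.ofReal (∫ z in x₀ +ᵥ (r • {y : EuclideanSpace ℝ (Fin 3) |
          ∀ ν : EuclideanSpace ℝ (Fin 3), ⟪y, ν⟫ ≤ Real.sqrt 2 / 4 *
            ∑ᶠ w ∈ {w | w ∈ fccStacking 1 (Real.sqrt (2 / 3)) ∧ ‖w‖ = 1}, |⟪w, A.symm ν⟫|}),
          fieldDivergence ξ z)).toReal = 96 * r ^ 2 := by
  obtain ⟨L, hL⟩ := exists_linearIsometryEquiv_unitShell_eq
  change (anisotropicPerimeter _ _).toReal = 96 * r ^ 2
  have hK : IsCompact ((L.trans A) '' fccWulffBody) :=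
    isCompact_fccWulffBody.image (L.trans A).continuous
  have hKc : Convex ℝ ((L.trans A) '' fccWulffBody) :=
    convex_fccWulffBody.linear_image (L.trans A).toLinearEquiv.toLinearMap
  have h0 : (0 : EuclideanSpace ℝ (Fin 3)) ∈ (L.trans A) '' fccWulffBody :=
    ⟨0, zero_mem_fccWulffBody, by simp⟩
  have hvol : volume ((L.trans A) '' fccWulffBody) = ENNReal.ofReal 32 := by
    rw [← cruxWulffBody_eq_image_fccWulffBody hL A, volume_cruxWulffBody]
  rw [cruxWulffBody_eq_image_fccWulffBody hL A,
    anisotropicPerimeter_vadd_smul_self (n := 3) (by norm_num) hK hKc h0 x₀ hr, hvol,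
    show (3 : ℕ) - 1 = 2 from rfl, show ((3 : ℕ) : ℝ≥0∞) = ENNReal.ofReal 3 by norm_num,
    ← ENNReal.ofReal_mul (by norm_num), ← ENNReal.ofReal_mul (by positivity),
    ENNReal.toReal_ofReal (by positivity)]
  ring

/-- **`|x₀ + r·W_A| = 32·r³`** (`r > 0`): the volume of a translated, dilated Wulff grain. -/
theorem volume_vadd_smul_cruxWulffBody
    (A : EuclideanSpace ℝ (Fin 3) ≃ₗᵢ[ℝ] EuclideanSpace ℝ (Fin 3))
    (x₀ : EuclideanSpace ℝ (Fin 3)) {r : ℝ} (hr : 0 < r) :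
    (volume (x₀ +ᵥ (r • {y : EuclideanSpace ℝ (Fin 3) | ∀ ν : EuclideanSpace ℝ (Fin 3), ⟪y, ν⟫ ≤
        Real.sqrt 2 / 4 * ∑ᶠ w ∈ {w | w ∈ fccStacking 1 (Real.sqrt (2 / 3)) ∧ ‖w‖ = 1},
          |⟪w, A.symm ν⟫|}))).toReal = 32 * r ^ 3 := by
  rw [measure_vadd, Measure.addHaar_smul_of_nonneg volume hr.le, volume_cruxWulffBody,
    finrank_euclideanSpace, Fintype.card_fin, ← ENNReal.ofReal_mul (by positivity),
    ENNReal.toReal_ofReal (by positivity)]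
  ring

/-- The arithmetic of the equality case: `6·2^{1/3}·(√2·(32 r³))^{2/3} = 96 r²` for `r > 0`
(`(32√2)^{2/3} = (2^{11/2})^{2/3} = 2^{11/3}`, `6·2^{1/3}·2^{11/3} = 6·16`). -/
theorem wulff_constant_smul {r : ℝ} (hr : 0 < r) :
    6 * (2 : ℝ) ^ ((1 : ℝ) / 3) * (Real.sqrt 2 * (32 * r ^ 3)) ^ ((2 : ℝ) / 3) = 96 * r ^ 2 := by
  rw [wulff_constant_eq (by positivity : (0:ℝ) ≤ 32 * r ^ 3)]
  have hr3 : (r ^ 3) ^ ((3 : ℝ)⁻¹) = r := by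
    have h := Real.pow_rpow_inv_natCast hr.le (n := 3) (by norm_num)
    simpa using h
  have hmul : (32 * r ^ 3) ^ ((3 : ℝ)⁻¹) = (32 : ℝ) ^ ((3 : ℝ)⁻¹) * r := by
    rw [Real.mul_rpow (by norm_num) (by positivity), hr3]
  have hs3 : ((32 : ℝ) ^ ((3 : ℝ)⁻¹)) ^ 3 = 32 := by
    have h := Real.rpow_inv_natCast_pow (show (0 : ℝ) ≤ 32 by norm_num) (n := 3) (by norm_num)
    simpa using h
  rw [hmul]
  linear_combination (3 * r ^ 2) * hs3

section WulffGrain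

open Metric
open Literature.Analysis.Convexity (anisotropicPerimeter_lt_top_iff)

/-! ### The Wulff grain `x₀ + r·W_A` is an admissible one-grain texture -/

/-- The crux's Wulff body `W_A` is compact. -/
theorem isCompact_cruxWulffBody (A : EuclideanSpace ℝ (Fin 3) ≃ₗᵢ[ℝ] EuclideanSpace ℝ (Fin 3)) :
    IsCompact {y : EuclideanSpace ℝ (Fin 3) | ∀ ν : EuclideanSpace ℝ (Fin 3), ⟪y, ν⟫ ≤ Real.sqrt 2 / 4 *
        ∑ᶠ w ∈ {w | w ∈ fccStacking 1 (Real.sqrt (2 / 3)) ∧ ‖w‖ = 1}, |⟪w, A.symm ν⟫|} := by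
  obtain ⟨L, hL⟩ := exists_linearIsometryEquiv_unitShell_eq
  rw [cruxWulffBody_eq_image_fccWulffBody hL A]
  exact isCompact_fccWulffBody.image (L.trans A).continuous

/-- The crux's Wulff body contains the ball of radius `√3` (the in-radius of `conv{perm(0,±1,±2)}`:
`√3·‖ν‖ ≤ φ_fcc(ν)`). -/
theorem closedBall_subset_cruxWulffBody
    (A : EuclideanSpace ℝ (Fin 3) ≃ₗᵢ[ℝ] EuclideanSpace ℝ (Fin 3)) :
    closedBall (0 : EuclideanSpace ℝ (Fin 3)) (Real.sqrt 3) ⊆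
      {y : EuclideanSpace ℝ (Fin 3) | ∀ ν : EuclideanSpace ℝ (Fin 3), ⟪y, ν⟫ ≤ Real.sqrt 2 / 4 *
        ∑ᶠ w ∈ {w | w ∈ fccStacking 1 (Real.sqrt (2 / 3)) ∧ ‖w‖ = 1}, |⟪w, A.symm ν⟫|} := by
  obtain ⟨L, hL⟩ := exists_linearIsometryEquiv_unitShell_eq
  intro y hy ν
  rw [mem_closedBall, dist_zero_right] at hy
  rw [phiBarlow_eq_phiFcc hL]
  calc ⟪y, ν⟫ ≤ ‖y‖ * ‖ν‖ := real_inner_le_norm _ _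
    _ ≤ Real.sqrt 3 * ‖ν‖ := by gcongr
    _ = Real.sqrt 3 * ‖L.symm (A.symm ν)‖ := by
        rw [LinearIsometryEquiv.norm_map, LinearIsometryEquiv.norm_map]
    _ ≤ phiFcc (L.symm (A.symm ν)) := sqrt_three_mul_norm_le_phiFcc _

/-- The crux's Wulff body lies in the ball of radius `√5` (`φ_fcc(ν) ≤ √5·‖ν‖`). -/
theorem cruxWulffBody_subset_closedBall
    (A : EuclideanSpace ℝ (Fin 3) ≃ₗᵢ[ℝ] EuclideanSpace ℝ (Fin 3)) :
    {y : EuclideanSpace ℝ (Fin 3) | ∀ ν : EuclideanSpace ℝ (Fin 3), ⟪y, ν⟫ ≤ Real.sqrt 2 / 4 *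
        ∑ᶠ w ∈ {w | w ∈ fccStacking 1 (Real.sqrt (2 / 3)) ∧ ‖w‖ = 1}, |⟪w, A.symm ν⟫|} ⊆
      closedBall (0 : EuclideanSpace ℝ (Fin 3)) (Real.sqrt 5) := by
  obtain ⟨L, hL⟩ := exists_linearIsometryEquiv_unitShell_eq
  intro y hy
  rw [wulffBody_eq_image hL A] at hy
  obtain ⟨x, hx, rfl⟩ := hy
  rw [mem_closedBall, dist_zero_right, LinearIsometryEquiv.norm_map]
  exact norm_le_of_mem_wulffCubic hx

/-- **`|x₀ + r·W_A| = 32·r³`** (`r > 0`), `ℝ≥0∞`-valued form. -/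
theorem volume_vadd_smul_cruxWulffBody'
    (A : EuclideanSpace ℝ (Fin 3) ≃ₗᵢ[ℝ] EuclideanSpace ℝ (Fin 3))
    (x₀ : EuclideanSpace ℝ (Fin 3)) {r : ℝ} (hr : 0 < r) :
    volume (x₀ +ᵥ (r • {y : EuclideanSpace ℝ (Fin 3) | ∀ ν : EuclideanSpace ℝ (Fin 3), ⟪y, ν⟫ ≤
        Real.sqrt 2 / 4 * ∑ᶠ w ∈ {w | w ∈ fccStacking 1 (Real.sqrt (2 / 3)) ∧ ‖w‖ = 1},
          |⟪w, A.symm ν⟫|})) = ENNReal.ofReal (32 * r ^ 3) := by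
  rw [measure_vadd, Measure.addHaar_smul_of_nonneg volume hr.le, volume_cruxWulffBody,
    finrank_euclideanSpace, Fintype.card_fin, ← ENNReal.ofReal_mul (by positivity)]
  congr 1
  ring

/-- **The Wulff grain `x₀ + r·W_A` has finite perimeter** (`r > 0`): it is compact (hence measurable)
and `√3·Per ≤ Per_{W_A} = 96 r² < ∞` because `B̄_{√3} ⊆ W_A ⊆ B̄_{√5}`. So
`(x₀ + r·W_A, A)` is an admissible one-grain texture of the crux (`Tex 1`). -/
theorem hasFinitePerimeter_vadd_smul_cruxWulffBody
    (A : EuclideanSpace ℝ (Fin 3) ≃ₗᵢ[ℝ] EuclideanSpace ℝ (Fin 3))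
    (x₀ : EuclideanSpace ℝ (Fin 3)) {r : ℝ} (hr : 0 < r) :
    HasFinitePerimeter (x₀ +ᵥ (r • {y : EuclideanSpace ℝ (Fin 3) |
      ∀ ν : EuclideanSpace ℝ (Fin 3), ⟪y, ν⟫ ≤ Real.sqrt 2 / 4 *
        ∑ᶠ w ∈ {w | w ∈ fccStacking 1 (Real.sqrt (2 / 3)) ∧ ‖w‖ = 1}, |⟪w, A.symm ν⟫|})) := by
  refine ⟨(((isCompact_cruxWulffBody A).smul r).vadd x₀).isClosed.measurableSet, ?_⟩
  rw [← anisotropicPerimeter_lt_top_iff (Real.sqrt_pos.2 (by norm_num : (0:ℝ) < 3))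
    (Real.sqrt_pos.2 (by norm_num : (0:ℝ) < 5)) (closedBall_subset_cruxWulffBody A)
    (cruxWulffBody_subset_closedBall A)]
  have h := per_cruxWulffBody_vadd_smul A x₀ hr
  by_contra htop
  rw [not_lt, top_le_iff] at htop
  have h' := h
  rw [show (⨆ (ξ : EuclideanSpace ℝ (Fin 3) → EuclideanSpace ℝ (Fin 3))
        (_ : ContDiff ℝ 1 ξ ∧ HasCompactSupport ξ ∧ ∀ z, ξ z ∈
          {y : EuclideanSpace ℝ (Fin 3) | ∀ ν : EuclideanSpace ℝ (Fin 3), ⟪y, ν⟫ ≤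
            Real.sqrt 2 / 4 * ∑ᶠ w ∈ {w | w ∈ fccStacking 1 (Real.sqrt (2 / 3)) ∧ ‖w‖ = 1},
              |⟪w, A.symm ν⟫|}),
        ENNReal.ofReal (∫ z in x₀ +ᵥ (r • {y : EuclideanSpace ℝ (Fin 3) |
          ∀ ν : EuclideanSpace ℝ (Fin 3), ⟪y, ν⟫ ≤ Real.sqrt 2 / 4 *
            ∑ᶠ w ∈ {w | w ∈ fccStacking 1 (Real.sqrt (2 / 3)) ∧ ‖w‖ = 1}, |⟪w, A.symm ν⟫|}),
          fieldDivergence ξ z)) = anisotropicPerimeter _ _ from rfl, htop, ENNReal.toReal_top] at h'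
  have : (0 : ℝ) < 96 * r ^ 2 := by positivity
  linarith

/-- **The volume of the Wulff grain is finite** (`Tex 1` admissibility, second clause). -/
theorem volume_vadd_smul_cruxWulffBody_lt_top
    (A : EuclideanSpace ℝ (Fin 3) ≃ₗᵢ[ℝ] EuclideanSpace ℝ (Fin 3))
    (x₀ : EuclideanSpace ℝ (Fin 3)) {r : ℝ} (hr : 0 < r) :
    volume (x₀ +ᵥ (r • {y : EuclideanSpace ℝ (Fin 3) | ∀ ν : EuclideanSpace ℝ (Fin 3), ⟪y, ν⟫ ≤
        Real.sqrt 2 / 4 * ∑ᶠ w ∈ {w | w ∈ fccStacking 1 (Real.sqrt (2 / 3)) ∧ ‖w‖ = 1},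
          |⟪w, A.symm ν⟫|})) < ⊤ := by
  rw [volume_vadd_smul_cruxWulffBody' A x₀ hr]
  exact ENNReal.ofReal_lt_top


/-! ### The Wulff grain as a one-grain texture of the crux, verbatim -/

open scoped InnerProductSpace in
/-- **Every Wulff grain is an exact one-grain minimiser of `PolycrystalWulffBound`** — the crux's
`let`-bindings copied verbatim: for every orientation `A₀`, centre `x₀` and radius `r > 0`, the single
texture `G = (x₀ + r·W_{A₀})`, `A = A₀` (any `c`, `m`) is ADMISSIBLE (`Tex 1`), has energy
`En = Per_{W_{A₀}}(x₀ + r W_{A₀}) = 96 r²`, volume `Vol = 32 r³`, and realises EQUALITY in the crux's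
inequality: `6·2^{1/3}·(√2·Vol)^{2/3} = En`. (Input of the sanity reduction
«LiminfAssembly ∧ [Per_W(W) = 96] ⟹ TextureLiminf»: the grain with `√2·32 r³ = 1 − δ/2` has energy
`6·2^{1/3}(1 − δ/2)^{2/3}`.) -/
theorem polycrystalWulffBound_wulffGrain :
      let Λ : Set (EuclideanSpace ℝ (Fin 3)) := Literature.MathematicalPhysics.StatisticalMechanics.fccStacking 1 (Real.sqrt (2 / 3));
    let Brl : (ℤ → ℤ) → Set (EuclideanSpace ℝ (Fin 3)) := Literature.MathematicalPhysics.StatisticalMechanics.barlowStacking 1 (Real.sqrt (2 / 3));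
    let Ax : EuclideanSpace ℝ (Fin 3) → (EuclideanSpace ℝ (Fin 3) ≃ₗᵢ[ℝ] EuclideanSpace ℝ (Fin 3)) → (EuclideanSpace ℝ (Fin 3) ≃ₗᵢ[ℝ] EuclideanSpace ℝ (Fin 3)) → Prop := fun m A B => ∃ (L : EuclideanSpace ℝ (Fin 3) ≃ₗᵢ[ℝ] EuclideanSpace ℝ (Fin 3)) (s₁ s₂ : EuclideanSpace ℝ (Fin 3)) (σ σ' : ℤ → ℤ), Literature.MathematicalPhysics.StatisticalMechanics.IsHaggSeq σ ∧ Literature.MathematicalPhysics.StatisticalMechanics.IsHaggSeq σ' ∧ L (EuclideanSpace.single (2 : Fin 3) (1 : ℝ)) = m ∧ A '' Λ ⊆ (fun q => L q + s₁) '' Brl σ ∧ B '' Λ ⊆ (fun q => L q + s₂) '' Brl σ';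
    let CoAx : (EuclideanSpace ℝ (Fin 3) ≃ₗᵢ[ℝ] EuclideanSpace ℝ (Fin 3)) → (EuclideanSpace ℝ (Fin 3) ≃ₗᵢ[ℝ] EuclideanSpace ℝ (Fin 3)) → Prop := fun A B => ∃ m, Ax m A B;
    let Φ : EuclideanSpace ℝ (Fin 3) → ℝ := fun ν => Real.sqrt 2 / 4 * ∑ᶠ w ∈ {w ∈ Λ | ‖w‖ = 1}, |⟪w, ν⟫_ℝ|;
    let Per : Set (EuclideanSpace ℝ (Fin 3)) → Set (EuclideanSpace ℝ (Fin 3)) → ℝ := fun K S => (⨆ (ξ : EuclideanSpace ℝ (Fin 3) → EuclideanSpace ℝ (Fin 3)) (_ : ContDiff ℝ 1 ξ ∧ HasCompactSupport ξ ∧ ∀ z, ξ z ∈ K), ENNReal.ofReal (∫ z in S, Literature.MathematicalPhysics.StatisticalMechanics.fieldDivergence ξ z)).toReal;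
    let ι : Set (EuclideanSpace ℝ (Fin 3)) → Set (EuclideanSpace ℝ (Fin 3)) → Set (EuclideanSpace ℝ (Fin 3)) → ℝ := fun K S₁ S₂ => (Per K S₁ + Per K S₂ - Per K (S₁ ∪ S₂)) / 2;
    let W : (EuclideanSpace ℝ (Fin 3) ≃ₗᵢ[ℝ] EuclideanSpace ℝ (Fin 3)) → Set (EuclideanSpace ℝ (Fin 3)) := fun A => {y | ∀ ν : EuclideanSpace ℝ (Fin 3), ⟪y, ν⟫_ℝ ≤ Φ (A.symm ν)};
    let Dsc : EuclideanSpace ℝ (Fin 3) → Set (EuclideanSpace ℝ (Fin 3)) := fun m => {y | ‖y‖ ≤ 1 ∧ ⟪y, m⟫_ℝ = 0};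
    let Tex : (n : ℕ) → (Fin n → Set (EuclideanSpace ℝ (Fin 3))) → (Fin n → (EuclideanSpace ℝ (Fin 3) ≃ₗᵢ[ℝ] EuclideanSpace ℝ (Fin 3))) → (Fin n → Fin n → ℝ) → (Fin n → Fin n → EuclideanSpace ℝ (Fin 3)) → Prop := fun n G A c m => (∀ f : Fin n, Literature.MathematicalPhysics.StatisticalMechanics.HasFinitePerimeter (G f) ∧ volume (G f) < ⊤) ∧ (∀ f g, f ≠ g → Disjoint (G f) (G g)) ∧ (∀ f g, f ≠ g → 0 ≤ c f g) ∧ (∀ f g, f ≠ g → ¬ CoAx (A f) (A g) → m f g = 0 ∧ 1 ≤ c f g) ∧ (∀ f g, f ≠ g → CoAx (A f) (A g) → A f '' Λ ≠ A g '' Λ → Ax (m f g) (A f) (A g) ∧ 1 / 2 ≤ c f g);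
    let En : (n : ℕ) → (Fin n → Set (EuclideanSpace ℝ (Fin 3))) → (Fin n → (EuclideanSpace ℝ (Fin 3) ≃ₗᵢ[ℝ] EuclideanSpace ℝ (Fin 3))) → (Fin n → Fin n → ℝ) → (Fin n → Fin n → EuclideanSpace ℝ (Fin 3)) → ℝ := fun n G A c m => ∑ f : Fin n, Per (W (A f)) (G f) - ∑ f, ∑ g, (if f = g then 0 else ι (W (A f)) (G f) (G g)) + ∑ f, ∑ g, (if f = g then 0 else c f g / 2 * ι (Dsc (m f g)) (G f) (G g));
    let Vol : (n : ℕ) → (Fin n → Set (EuclideanSpace ℝ (Fin 3))) → ℝ := fun n G => (volume (⋃ f : Fin n, G f)).toReal;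
    ∀ (A₀ : EuclideanSpace ℝ (Fin 3) ≃ₗᵢ[ℝ] EuclideanSpace ℝ (Fin 3)) (x₀ : EuclideanSpace ℝ (Fin 3)) (r : ℝ), 0 < r →
    ∀ (c : Fin 1 → Fin 1 → ℝ) (m : Fin 1 → Fin 1 → EuclideanSpace ℝ (Fin 3)),
      Tex 1 (fun _ => x₀ +ᵥ (r • W A₀)) (fun _ => A₀) c m ∧
      En 1 (fun _ => x₀ +ᵥ (r • W A₀)) (fun _ => A₀) c m = 96 * r ^ 2 ∧
      Vol 1 (fun _ => x₀ +ᵥ (r • W A₀)) = 32 * r ^ 3 ∧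
      6 * (2 : ℝ) ^ ((1 : ℝ) / 3) * (Real.sqrt 2 * Vol 1 (fun _ => x₀ +ᵥ (r • W A₀))) ^ ((2 : ℝ) / 3) =
        En 1 (fun _ => x₀ +ᵥ (r • W A₀)) (fun _ => A₀) c m := by
  intro Λ Brl Ax CoAx Φ Per ι W Dsc Tex En Vol A₀ x₀ r hr c m
  have hne : ∀ f g : Fin 1, f ≠ g → False := fun f g h => h (Subsingleton.elim f g)
  have hEn : En 1 (fun _ => x₀ +ᵥ (r • W A₀)) (fun _ => A₀) c m = 96 * r ^ 2 := by
    show (∑ f : Fin 1, Per (W A₀) (x₀ +ᵥ (r • W A₀)) - ∑ f : Fin 1, ∑ g : Fin 1,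
        (if f = g then 0 else ι (W A₀) (x₀ +ᵥ (r • W A₀)) (x₀ +ᵥ (r • W A₀))) +
        ∑ f : Fin 1, ∑ g : Fin 1, (if f = g then 0 else
          c f g / 2 * ι (Dsc (m f g)) (x₀ +ᵥ (r • W A₀)) (x₀ +ᵥ (r • W A₀)))) = 96 * r ^ 2
    simp only [Finset.univ_unique, Fin.default_eq_zero, Finset.sum_singleton, if_true, sub_zero,
      add_zero]
    exact per_cruxWulffBody_vadd_smul A₀ x₀ hr
  have hVol : Vol 1 (fun _ => x₀ +ᵥ (r • W A₀)) = 32 * r ^ 3 := by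
    show (volume (⋃ f : Fin 1, x₀ +ᵥ (r • W A₀))).toReal = 32 * r ^ 3
    rw [Set.iUnion_const]
    exact volume_vadd_smul_cruxWulffBody A₀ x₀ hr
  refine ⟨⟨fun _ => ⟨hasFinitePerimeter_vadd_smul_cruxWulffBody A₀ x₀ hr,
      volume_vadd_smul_cruxWulffBody_lt_top A₀ x₀ hr⟩, fun f g h => (hne f g h).elim,
      fun f g h => (hne f g h).elim, fun f g h => (hne f g h).elim, fun f g h => (hne f g h).elim⟩,
    hEn, hVol, ?_⟩
  rw [hEn, hVol]
  exact wulff_constant_smul hr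

end WulffGrain

end Summit.Ventures.Crystal3D.Theorems

end
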